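import Mathlib
import Literature.Computability.AlgebraicComplexity.GroupTheoreticMatMul
import Literature.Barriers.MatrixMultiplication.TricoloredSumFreeBarrier
import Summits.MatrixMultiplication.MatrixMultiplication.Theorems.GroupTheoreticSTPPCAbelianObstructionNegSlack

/-!
# The second-moment slack rule (U11-Δ) for STPP families in finite abelian groups

Support file for route `MatrixMultiplication/GroupTheoreticSTPP`, negative crux
`stmt-MatrixMultiplication-0596` (`CAbelianObstructionNeg`): finite-range evidence — part 2 of the kernel
form of the cell mm-stpp rules (part 1: `…Slack.lean`, U11-min).  **U11-Δ** (second-moment slack rule,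
HOME/mm-stpp-lit/KNESER-KILLS.md §4), with the `|X − X|` step done by an elementary
very-small-difference-set lemma instead of Kneser's theorem, so that the whole rule is ONE arithmetic
certificate (`certificate_C/A/B`).  By plain arithmetic these certificates exclude every residual instance
of the abelian `T_E` census at orders `111, 120, 121, 124, 125, 126, 127` (HOME/CENSUS-PLAN.md §6.1,
Q3.8–Q3.12; discharged in a separate file over the census definitions).

Setting and notation as in part 1: `(A i, B i, C i)_{i < N}` an STPP family (tree `IsSTPP`) in a finite
abelian group `H`, `M = |H|`; `X = ⋃ (A i − B i)`, `Y = ⋃ (B i − C i)`, `Z = ⋃ (A i − C i)` with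
`|X| = Σ aᵢbᵢ`, `|Y| = Σ bᵢcᵢ`, `|Z| = Σ aᵢcᵢ`.

* `sum_card_inter_vadd`: `Σ_δ |Y ∩ (δ + Y)| = |Y|²`.
* **Lemma Δ / second moment** (`second_moment_C`): with `m ≥` all `cᵢ` and `L = 2Σbc + Σca − M − 2m`,
  every `δ ∈ X − X` is a near-period of `Y`: `|Y ∩ (δ + Y)| ≥ L`; summing over `δ ∈ X − X` inside the
  identity gives `Σbc + (|X − X| − 1)·L ≤ (Σbc)²`.
* **Very small difference sets** (`sub_mem_sub_of_small`, `card_sub_dvd_card`): if `2|X − X| < 3|X|`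
  then `X − X` is a subgroup, so `|X − X|` divides `M` (elementary double counting; compare Freiman's
  `3/2` theorem, Mathlib `Finset.doubling_lt_three_halves`, which assumes small `|X + X|` instead).
* `certificate_C` (+ rotations `_A`, `_B` via `IsSTPP.rotate`): there is `D` (`= |X − X|`) with
  `Σab ≤ D ≤ M`, `3Σab ≤ 2D ∨ D ∣ M`, and `Σbc + (D − 1)·L ≤ (Σbc)²` — a decidable arithmetic test on the
  shape list (example: four `(4,4,4)` members at `M = 127`: `Σ = 64`, `L = 57`, `D ∈ [64,127]` with
  `D ≥ 96 ∨ D ∣ 127` forces `64 + 95·57 ≤ 4096`, false).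

WHAT THIS IS NOT: necessary conditions only (no STPP family is constructed, no `ω` statement); the rule
is silent on the CKSU Prop. 5.2 pairs and on every known STPP object.

## References
* H. Cohn, R. Kleinberg, B. Szegedy, C. Umans, FOCS 2005, Def. 5.1 (STPP).
* G. A. Freiman, *Groups and the inverse problems of additive number theory* (1973) (the `3/2` theorem;
  here only the elementary difference-set variant is used).
-/

-- single-conjunct summit: the mandated namespace repeats `MatrixMultiplication`.
set_option linter.dupNamespace false

namespace Summit.MatrixMultiplication.MatrixMultiplication.Theorems

namespace STPPSlack

open Finset Literature.Computability.AlgebraicComplexity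
open scoped Pointwise

variable {H : Type*} [AddCommGroup H] [DecidableEq H] {N : ℕ} {A B C : Fin N → Finset H}

/-! ### The second-moment identity and Lemma Δ -/

/-- `Σ_δ |Y ∩ (δ + Y)| = |Y|²` (count the pairs `(y, y') ∈ Y × Y` by their difference). [folklore] -/
theorem sum_card_inter_vadd [Fintype H] (Y : Finset H) :
    ∑ δ : H, (Y ∩ (δ +ᵥ Y)).card = Y.card * Y.card := by
  rw [← Finset.card_product Y Y, card_eq_sum_card_fiberwise (f := fun p : H × H => p.1 - p.2)
    (s := Y ×ˢ Y) (t := (univ : Finset H)) (fun _ _ => mem_coe.2 (mem_univ _))]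
  refine sum_congr rfl fun δ _ => ?_
  symm
  refine card_nbij' (fun p => p.1) (fun y => (y, y - δ)) ?_ ?_ ?_ ?_
  · intro p hp
    rw [mem_coe, mem_filter, mem_product] at hp
    rw [mem_coe, mem_inter, mem_vadd_finset]
    exact ⟨hp.1.1, p.2, hp.1.2, by rw [vadd_eq_add, ← hp.2, sub_add_cancel]⟩
  · intro y hy
    rw [mem_coe, mem_inter, mem_vadd_finset] at hy
    obtain ⟨hy, y', hy', hyy⟩ := hy
    rw [mem_coe, mem_filter, mem_product]
    refine ⟨⟨hy, ?_⟩, sub_sub_cancel _ _⟩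
    have : y - δ = y' := by rw [← hyy, vadd_eq_add, add_sub_cancel_left]
    show y - δ ∈ Y
    rw [this]; exact hy'
  · intro p hp
    rw [mem_coe, mem_filter] at hp
    ext
    · rfl
    · show p.1 - δ = p.2
      rw [← hp.2, sub_sub_cancel]
  · intro y _
    rfl

/-- **Second-moment slack rule (U11-Δ, `C`-form).** For an STPP family with all `A i`, `B i` non-empty in a
finite abelian group `H`, `M = |H|`, `m ≥ |C i|` for all `i`, `X = ⋃ (A i − B i)`, `Σbc = Σ |B i||C i|`,
`Σca = Σ |A i||C i|`: `Σbc + (|X − X| − 1) · (2Σbc + Σca − M − 2m) ≤ (Σbc)²` (truncated subtraction).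
Proof: for `x₀ ∈ A t − B t` the set `H ∖ ((x₀ + Y) ∪ Z)` has at most `σ = M + m − Σbc − Σca` elements
(U11-min count), so for `x₀, x₁ ∈ X` the translates `x₀ + Y`, `x₁ + Y` share at least `M − Σca − 2σ`
points (**Lemma Δ**); sum `|Y ∩ (δ + Y)|` over `δ ∈ X − X` inside `Σ_δ |Y ∩ (δ + Y)| = |Y|²`.
(HOME/mm-stpp-lit/KNESER-KILLS.md §4, there with Kneser for `|X − X|`.) [original] -/
theorem second_moment_C [Fintype H] (h : IsSTPP A B C) (hA : ∀ i, (A i).Nonempty)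
    (hB : ∀ i, (B i).Nonempty) {m : ℕ} (hm : ∀ i, (C i).card ≤ m) :
    ∑ i, (B i).card * (C i).card +
        (((univ.biUnion fun i => A i - B i) - univ.biUnion fun i => A i - B i).card - 1) *
          (2 * ∑ i, (B i).card * (C i).card + ∑ i, (A i).card * (C i).card -
            (Fintype.card H + 2 * m)) ≤
      (∑ i, (B i).card * (C i).card) * ∑ i, (B i).card * (C i).card := by
  set X := univ.biUnion fun i => A i - B i with hXdef
  set Y := univ.biUnion fun j => B j - C j with hYdef
  set Z := univ.biUnion fun k => A k - C k with hZdef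
  set Sbc := ∑ i, (B i).card * (C i).card with hSbc
  set Sca := ∑ i, (A i).card * (C i).card with hSca
  set M := Fintype.card H with hM
  have hYc : Y.card = Sbc := card_Y h hA
  have hZc : Z.card = Sca := card_Z h hB
  rcases isEmpty_or_nonempty (Fin N) with hN | ⟨⟨i₀⟩⟩
  · have hX0 : X = ∅ := by rw [hXdef, univ_eq_empty, biUnion_empty]
    have hS0 : Sbc = 0 := by rw [hSbc, univ_eq_empty, sum_empty]
    rw [hX0, hS0]; simp
  -- the defect of a translate: `E x₀ = H ∖ ((x₀ + Y) ∪ Z)` has at most `M + m − Sbc − Sca` elements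
  have hE : ∀ x₀ ∈ X, (univ \ ((x₀ +ᵥ Y) ∪ Z)).card ≤ M + m - (Sbc + Sca) := by
    intro x₀ hx₀
    rw [hXdef, mem_biUnion] at hx₀
    obtain ⟨i, -, hx₀⟩ := hx₀
    rw [mem_sub] at hx₀
    obtain ⟨s', hs', t, ht, rfl⟩ := hx₀
    have hint : (((s' - t) +ᵥ Y) ∩ Z).card ≤ m :=
      ((card_le_card (vadd_Y_inter_Z_subset h hs' ht)).trans card_image_le).trans (hm i)
    have hui := card_union_add_card_inter ((s' - t) +ᵥ Y) Z
    rw [card_vadd_finset, hYc, hZc] at hui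
    rw [card_univ_sdiff, ← hM]
    have := card_le_univ (((s' - t) +ᵥ Y) ∪ Z)
    rw [← hM] at this
    omega
  -- U11-min: `Sbc + Sca ≤ M + m`
  have hU11 : Sbc + Sca ≤ M + m := by
    have := slack_C h hA hB i₀
    have hsum : ∑ t, (C t).card * ((A t).card + (B t).card) = Sbc + Sca := by
      rw [hSbc, hSca, ← sum_add_distrib]; exact sum_congr rfl fun t _ => by ring
    rw [hsum] at this
    have := hm i₀
    omega
  -- Lemma Δ: every `δ ∈ X − X` is a near-period of `Y`
  have hΔ : ∀ δ ∈ X - X, 2 * Sbc + Sca - (M + 2 * m) ≤ (Y ∩ (δ +ᵥ Y)).card := by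
    intro δ hδ
    rw [mem_sub] at hδ
    obtain ⟨x₁, hx₁, x₀, hx₀, rfl⟩ := hδ
    have key : (-x₀) +ᵥ ((x₀ +ᵥ Y) ∩ (x₁ +ᵥ Y)) = Y ∩ ((x₁ - x₀) +ᵥ Y) := by
      rw [vadd_finset_inter, neg_vadd_vadd, vadd_vadd, neg_add_eq_sub]
    rw [← key, card_vadd_finset]
    -- the complement of `(x₀ + Y) ∩ (x₁ + Y)` lies in `Z ∪ E x₀ ∪ E x₁`
    have hcov : (univ : Finset H) ⊆ (x₀ +ᵥ Y) ∩ (x₁ +ᵥ Y) ∪ Z ∪ (univ \ ((x₀ +ᵥ Y) ∪ Z)) ∪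
        (univ \ ((x₁ +ᵥ Y) ∪ Z)) := by
      intro g _
      by_cases h0 : g ∈ x₀ +ᵥ Y <;> by_cases h1 : g ∈ x₁ +ᵥ Y <;> by_cases hz : g ∈ Z <;>
        simp [h0, h1, hz]
    have hMU : M = (univ : Finset H).card := by rw [card_univ, hM]
    have h1 := card_le_card hcov
    rw [← hMU] at h1
    have u1 := card_union_le ((x₀ +ᵥ Y) ∩ (x₁ +ᵥ Y) ∪ Z ∪ (univ \ ((x₀ +ᵥ Y) ∪ Z)))
      (univ \ ((x₁ +ᵥ Y) ∪ Z))
    have u2 := card_union_le ((x₀ +ᵥ Y) ∩ (x₁ +ᵥ Y) ∪ Z) (univ \ ((x₀ +ᵥ Y) ∪ Z))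
    have u3 := card_union_le ((x₀ +ᵥ Y) ∩ (x₁ +ᵥ Y)) Z
    have hE0 := hE x₀ hx₀
    have hE1 := hE x₁ hx₁
    rw [hZc] at u3
    omega
  -- sum over `δ`
  have h0X : (0 : H) ∈ X - X := by
    have hx : (A i₀ - B i₀).Nonempty := (hA i₀).sub (hB i₀)
    obtain ⟨x, hx⟩ := hx
    have hxX : x ∈ X := by rw [hXdef, mem_biUnion]; exact ⟨i₀, mem_univ _, hx⟩
    simpa using sub_mem_sub hxX hxX
  have hid := sum_card_inter_vadd Y
  rw [hYc] at hid
  have hle : ∑ δ ∈ X - X, (Y ∩ (δ +ᵥ Y)).card ≤ ∑ δ : H, (Y ∩ (δ +ᵥ Y)).card :=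
    sum_le_sum_of_subset (subset_univ _)
  rw [← add_sum_erase _ _ h0X, zero_vadd, inter_self, hYc] at hle
  have hconst : ((X - X).card - 1) * (2 * Sbc + Sca - (M + 2 * m)) ≤
      ∑ δ ∈ (X - X).erase 0, (Y ∩ (δ +ᵥ Y)).card := by
    rw [← card_erase_of_mem h0X]
    have := sum_le_sum fun δ (hδ : δ ∈ (X - X).erase 0) => hΔ δ (mem_of_mem_erase hδ)
    rwa [sum_const, smul_eq_mul] at this
  omega

/-! ### Very small difference sets are subgroups -/

/-- If `2|X − X| < 3|X|` then `X − X` is closed under subtraction: every `d ∈ X − X` has more than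
`|X|/2` representations `d = x − x'`, so two representation sets meet. [folklore] -/
theorem sub_mem_sub_of_small {X : Finset H} (hsmall : 2 * (X - X).card < 3 * X.card) {d₁ d₂ : H}
    (h₁ : d₁ ∈ X - X) (h₂ : d₂ ∈ X - X) : d₁ - d₂ ∈ X - X := by
  -- representation sets `S d = {x' ∈ X | x' + d ∈ X}` are large
  have rep : ∀ d ∈ X - X, X.card < 2 * (X.filter fun x' => x' + d ∈ X).card := by
    intro d hd
    rw [mem_sub] at hd
    obtain ⟨x₀, hx₀, x₀', hx₀', rfl⟩ := hd
    have hU : (((-x₀) +ᵥ X) ∪ ((-x₀') +ᵥ X)) ⊆ X - X := by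
      intro e he
      rw [mem_union, mem_vadd_finset, mem_vadd_finset] at he
      rcases he with ⟨x, hx, rfl⟩ | ⟨x, hx, rfl⟩
      · rw [vadd_eq_add, neg_add_eq_sub]; exact sub_mem_sub hx hx₀
      · rw [vadd_eq_add, neg_add_eq_sub]; exact sub_mem_sub hx hx₀'
    have hUc := card_le_card hU
    have hui := card_union_add_card_inter ((-x₀) +ᵥ X) ((-x₀') +ᵥ X)
    rw [card_vadd_finset, card_vadd_finset] at hui
    -- `(−x₀ + X) ∩ (−x₀' + X)` injects into the representation set of `x₀ − x₀'` via `e ↦ e + x₀'`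
    have hTle : (((-x₀) +ᵥ X) ∩ ((-x₀') +ᵥ X)).card ≤
        (X.filter fun x' => x' + (x₀ - x₀') ∈ X).card := by
      refine card_le_card_of_injOn (fun e => e + x₀') ?_ ?_
      · intro e he
        rw [mem_coe, mem_inter, mem_vadd_finset, mem_vadd_finset] at he
        obtain ⟨⟨x, hx, hxe⟩, ⟨x', hx', hxe'⟩⟩ := he
        rw [vadd_eq_add] at hxe hxe'
        simp only [mem_coe, mem_filter]
        refine ⟨?_, ?_⟩
        · have : e + x₀' = x' := by rw [← hxe']; abel
          rw [this]; exact hx'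
        · have : e + x₀' + (x₀ - x₀') = x := by rw [← hxe]; abel
          rw [this]; exact hx
      · intro e _ e' _ (hee : e + x₀' = e' + x₀')
        exact add_right_cancel hee
    omega
  have hS₁ := rep d₁ h₁
  have hS₂ := rep d₂ h₂
  set S₁ := X.filter fun x' => x' + d₁ ∈ X
  set S₂ := X.filter fun x' => x' + d₂ ∈ X
  have hsub : S₁ ∪ S₂ ⊆ X := union_subset (filter_subset _ _) (filter_subset _ _)
  have hUc := card_le_card hsub
  have hui := card_union_add_card_inter S₁ S₂
  have hne : (S₁ ∩ S₂).Nonempty := by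
    rw [← card_pos]; omega
  obtain ⟨w, hw⟩ := hne
  rw [mem_inter, mem_filter, mem_filter] at hw
  have : d₁ - d₂ = (w + d₁) - (w + d₂) := by abel
  rw [this]
  exact sub_mem_sub hw.1.2 hw.2.2

/-- If `X ≠ ∅` and `2|X − X| < 3|X|` then `X − X` is (the carrier of) a subgroup of `H`, so `|X − X|`
divides `|H|`. [folklore] -/
theorem card_sub_dvd_card [Fintype H] {X : Finset H} (hX : X.Nonempty)
    (hsmall : 2 * (X - X).card < 3 * X.card) : (X - X).card ∣ Fintype.card H := by
  have hne : ((X - X : Finset H) : Set H).Nonempty := by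
    obtain ⟨x, hx⟩ := hX
    exact ⟨x - x, mem_coe.2 (sub_mem_sub hx hx)⟩
  let K : AddSubgroup H := AddSubgroup.ofSub ((X - X : Finset H) : Set H) hne
    (fun a ha b hb => by
      rw [mem_coe] at ha hb ⊢
      rw [← sub_eq_add_neg]
      exact sub_mem_sub_of_small hsmall ha hb)
  have hK : Nat.card K = (X - X).card := Nat.card_eq_finsetCard (X - X)
  rw [← Nat.card_eq_fintype_card, ← hK]
  exact AddSubgroup.card_addSubgroup_dvd_card K

/-! ### The arithmetic certificate -/

/-- **Certificate, `C`-form.** For an STPP family with all sets non-empty in a finite abelian group `H`,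
`M = |H|`, and `m ≥ |C i|` for all `i`, there is `D` (namely `|X − X|`, `X = ⋃ (A i − B i)`) with
`Σab ≤ D ≤ M`, `3Σab ≤ 2D ∨ D ∣ M`, and `Σbc + (D − 1)(2Σbc + Σca − M − 2m) ≤ (Σbc)²`. [original] -/
theorem certificate_C [Fintype H] (h : IsSTPP A B C) (hA : ∀ i, (A i).Nonempty)
    (hB : ∀ i, (B i).Nonempty) (hC : ∀ i, (C i).Nonempty) {m : ℕ} (hm : ∀ i, (C i).card ≤ m) :
    ∃ D : ℕ, ∑ i, (A i).card * (B i).card ≤ D ∧ D ≤ Fintype.card H ∧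
      (3 * ∑ i, (A i).card * (B i).card ≤ 2 * D ∨ D ∣ Fintype.card H) ∧
      ∑ i, (B i).card * (C i).card +
          (D - 1) * (2 * ∑ i, (B i).card * (C i).card + ∑ i, (A i).card * (C i).card -
            (Fintype.card H + 2 * m)) ≤
        (∑ i, (B i).card * (C i).card) * ∑ i, (B i).card * (C i).card := by
  set X := univ.biUnion fun i => A i - B i with hXdef
  have hXc : X.card = ∑ i, (A i).card * (B i).card := card_X h hC
  refine ⟨(X - X).card, ?_, card_le_univ _, ?_, second_moment_C h hA hB hm⟩
  · rcases isEmpty_or_nonempty (Fin N) with hN | ⟨⟨i₀⟩⟩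
    · have hX0 : X = ∅ := by rw [hXdef, univ_eq_empty, biUnion_empty]
      rw [← hXc, hX0]; simp
    · obtain ⟨x, hx⟩ : (A i₀ - B i₀).Nonempty := (hA i₀).sub (hB i₀)
      have hxX : x ∈ X := by rw [hXdef, mem_biUnion]; exact ⟨i₀, mem_univ _, hx⟩
      rw [← hXc, ← card_vadd_finset (-x) X]
      refine card_le_card fun e he => ?_
      rw [mem_vadd_finset] at he
      obtain ⟨x', hx', rfl⟩ := he
      rw [vadd_eq_add, neg_add_eq_sub]
      exact sub_mem_sub hx' hxX
  · by_cases hsmall : 2 * (X - X).card < 3 * X.card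
    · right
      rcases isEmpty_or_nonempty (Fin N) with hN | ⟨⟨i₀⟩⟩
      · exfalso
        have hX0 : X = ∅ := by rw [hXdef, univ_eq_empty, biUnion_empty]
        rw [hX0] at hsmall; simp at hsmall
      · obtain ⟨x, hx⟩ : (A i₀ - B i₀).Nonempty := (hA i₀).sub (hB i₀)
        have hxX : x ∈ X := by rw [hXdef, mem_biUnion]; exact ⟨i₀, mem_univ _, hx⟩
        exact card_sub_dvd_card ⟨x, hxX⟩ hsmall
    · left; rw [← hXc]; omega

/-- **Certificate, `A`-form** (rotation `(B, C, A)`; `m ≥ |A i|`): there is `D` with `Σbc ≤ D ≤ M`,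
`3Σbc ≤ 2D ∨ D ∣ M`, `Σca + (D − 1)(2Σca + Σab − M − 2m) ≤ (Σca)²`. [original] -/
theorem certificate_A [Fintype H] (h : IsSTPP A B C) (hA : ∀ i, (A i).Nonempty)
    (hB : ∀ i, (B i).Nonempty) (hC : ∀ i, (C i).Nonempty) {m : ℕ} (hm : ∀ i, (A i).card ≤ m) :
    ∃ D : ℕ, ∑ i, (B i).card * (C i).card ≤ D ∧ D ≤ Fintype.card H ∧
      (3 * ∑ i, (B i).card * (C i).card ≤ 2 * D ∨ D ∣ Fintype.card H) ∧
      ∑ i, (C i).card * (A i).card +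
          (D - 1) * (2 * ∑ i, (C i).card * (A i).card + ∑ i, (B i).card * (A i).card -
            (Fintype.card H + 2 * m)) ≤
        (∑ i, (C i).card * (A i).card) * ∑ i, (C i).card * (A i).card :=
  certificate_C h.rotate hB hC hA hm

/-- **Certificate, `B`-form** (rotation `(C, A, B)`; `m ≥ |B i|`): there is `D` with `Σca ≤ D ≤ M`,
`3Σca ≤ 2D ∨ D ∣ M`, `Σab + (D − 1)(2Σab + Σbc − M − 2m) ≤ (Σab)²`. [original] -/
theorem certificate_B [Fintype H] (h : IsSTPP A B C) (hA : ∀ i, (A i).Nonempty)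
    (hB : ∀ i, (B i).Nonempty) (hC : ∀ i, (C i).Nonempty) {m : ℕ} (hm : ∀ i, (B i).card ≤ m) :
    ∃ D : ℕ, ∑ i, (C i).card * (A i).card ≤ D ∧ D ≤ Fintype.card H ∧
      (3 * ∑ i, (C i).card * (A i).card ≤ 2 * D ∨ D ∣ Fintype.card H) ∧
      ∑ i, (A i).card * (B i).card +
          (D - 1) * (2 * ∑ i, (A i).card * (B i).card + ∑ i, (C i).card * (B i).card -
            (Fintype.card H + 2 * m)) ≤
        (∑ i, (A i).card * (B i).card) * ∑ i, (A i).card * (B i).card :=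
  certificate_C h.rotate.rotate hC hA hB hm

end STPPSlack

end Summit.MatrixMultiplication.MatrixMultiplication.Theorems
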